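/-
Copyright (c) 2026 the pub-hodgecm-mathlib formalisation cell (harness21).  Prover seat hodgecm-mathlib-F0P3a-p01 (g33), req620 Track A «(D-RAM) FOUR-FRAME» squad, unit U2H:
the (ρ2b′-X) child (U2H ED. 15 :418) — organ O-Lit brick 2 (wild anisotropic literal), file (α) «THE PARTNER PLANE» (PLAN v1 04:56Z; MAP v1 seams S3∕S5; payer lineage LH4-p14,
O-W LH4-p12 (g4) PAYER-PLAN v2 D2).  2026-09-04.
-/
import Literature.NumberTheory.Automorphic.EllipticPlaneAsFieldLineHermitian   -- ★ (LH4-p12 (g4)) `pairing_single_single`, `map_h_eq_h_of_hermitian`; brings ★ `UnitaryLatticeTreeDefs` (`pairing`)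
import HarnessLib

/-!
# Crux `H413`, line LH4 «(D-RAM) FOUR-FRAME» road — unit U2H, (ρ2b′-X), organ O-Lit brick 2, file (α): THE PARTNER PLANE OF AN ELLIPTIC HERMITIAN PLANE

Cell `hodgecm-mathlib` (D-0151), FLOOR 0, crux item H413 = `stmt-HodgeConjecture-24833`, route of record `HCCMUnconditional`; squad F0∕P3c∕LH4; registered stub served:
`F0P3cDyRamFourFrameU2H.stub_U2H_fixedPointCensus_typeTwo_unit0` ((ρ2b′-X), U2H ED. 15 :418) through the organs of RHO2BX-ORDER v1 (payer LH4-p14; MAP v1 seams S3 «O-Lit» and S5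
«N(ta)»).  THEOREMS ONLY (no `def`, no instance, no notation, no `sorry`); lane `--supports stmt-HodgeConjecture-24833 --as helper` (count-neutral).

WHAT THIS FILE DOES (pure algebra over the LINE MODEL of ★ part 1 p857255 ∕ ★ T3-E p857432; LH4-p12 (g3) PAYER-PLAN v2 §1 D2 «the anisotropic partner `W′ ↔ h′ = h·n₀`»).  Frame:
fields `E ⊂ M` (`jE`), `ρ Θ : M →+* M` with `ρ ∘ jE = jE`, `Θ ∘ jE = jE ∘ σ`, `ρρ = ΘΘ = id`, `Θρ = ρΘ`, `Fix ρ = jE(E)`; the line model `φ : E² → M` (`E`-semilinear, `φ(g x) = λ·φ x`,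
`Θ(λ)·λ = 1`) and form scalar `h` (`Θ h = h`) of a hermitian plane `(E², H₂)` with `g ∈ U(H₂)`: `jE⟨x, y⟩_{H₂} = h·Θ(φx)·φy + ρ(h·Θ(φx)·φy)`.  For ANY `n₀ ∈ M` with `Θ n₀ = n₀`:
* **`exists_partnerPlane`** — there is a `σ`-HERMITIAN `Ψ ∈ M₂(E)` for which the SAME `g` is unitary, whose pairing is the TWISTED trace form
  `jE⟨x, y⟩_Ψ = (h·n₀)·Θ(φx)·φy + ρ((h·n₀)·Θ(φx)·φy)` (so ★ (C) `EllipticPlaneAsFieldLine.ncard_selfDual_fixed_eq_ncard_orderLatt`, ★ (W4) and the O-Cone heads run on `(Ψ, g)` with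
  the same `φ, λ, α` and `h′ := h·n₀`), and whose determinant is `det Ψ = N_{M∕E}(n₀)·det H₂` read in `M`: `jE(det Ψ) = n₀·ρ(n₀)·jE(det H₂)`.
  With `N_{M∕E}(n₀) ∉ N_{E∕F}(E^×)` (file (β)) this is the ANISOTROPIC partner: `Ψ ⊥ ⟨a₁⟩ ≅ J₀` forces the line value `a₁` to be a non-norm, whence `κ = −(y_λ, θ)_v` (★ p857204).
* helpers: `map_add_self_eq` (`ρ`-symmetrisation is `ρ`-fixed), `eq_sum_single` (coordinates in `E²`); `⟨e_i, e_j⟩_H = H i j` is ★ `EllipticPlaneAsFieldLine.pairing_single_single`.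
HONEST LABEL.  Count-neutral helper (pure algebra); (ρ2b′-X) stays an OPEN prover target; `HC_CM` is proved only modulo the 7 printed citations (2 remaining named inputs: hLiu418 =
`stmt-HodgeConjecture-24832`, h413 = `stmt-HodgeConjecture-24833`) until rung 0 closes.

## References
* [Rogawski1990] J. D. Rogawski, *Automorphic Representations of Unitary Groups in Three Variables*, Ann. of Math. Stud. 123 (1990), §3.5 Prop. 3.5.2 (c) p. 29, §3.6 pp. 28–31,
  §4.9 Prop. 4.9.1 p. 55 (the two classes of hermitian planes carrying a given elliptic torus; `κ`).
* [Jacobowitz1962] R. Jacobowitz, *Hermitian forms over local fields*, Amer. J. Math. 84 (1962), §4 (hermitian lines `Tr(h·ā·b)`; scaling the line by `n₀ ∈ K♮` multiplies the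
  discriminant by `N(n₀)`).
* [LabesseLanglands1979] J.-P. Labesse, R. P. Langlands, *L-indistinguishability for SL(2)*, Canad. J. Math. 31 (1979), §2 pp. 8–10.
-/

set_option autoImplicit false

noncomputable section

namespace Summit.HodgeConjecture.HodgeConjecture.Cruxes.H413.F0P3cDyRamPartnerPlane

open Matrix
open Literature.NumberTheory.Automorphic.UnitaryLatticeTree (pairing)
open Literature.NumberTheory.Automorphic.EllipticPlaneAsFieldLine (pairing_single_single)
open scoped Matrix

variable {E M : Type} [Field E] [Field M]

/-! ## §1 Small helpers -/

/-- For an involution `ρ`, `z + ρ z` is `ρ`-fixed. [cite: Jacobowitz1962, §4] -/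
theorem map_add_self_eq (ρ : M →+* M) (hρρ : ∀ z, ρ (ρ z) = z) (z : M) : ρ (z + ρ z) = z + ρ z := by
  rw [map_add, hρρ, add_comm]

/-- A vector of `E²` in the standard basis: `x = x₀•e₀ + x₁•e₁`. [cite: Jacobowitz1962, §4] -/
theorem eq_sum_single (x : Fin 2 → E) : x = x 0 • (Pi.single 0 1 : Fin 2 → E) + x 1 • (Pi.single 1 1 : Fin 2 → E) := by
  ext i; fin_cases i <;> simp

/-! ## §2 The partner plane -/

/-- **O-Lit brick 2 (α): THE PARTNER PLANE.**  In the frame of the module docstring, for every `n₀ ∈ M` with `Θ n₀ = n₀` there is `Ψ ∈ M₂(E)` with: `(σΨ)ᵀ = Ψ`; `g` unitary for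
`pairing σ Ψ`; `jE⟨x, y⟩_Ψ = (h·n₀)·Θ(φx)·φy + ρ((h·n₀)·Θ(φx)·φy)` for all `x, y`; and `jE(det Ψ) = n₀·ρ(n₀)·jE(det H₂)`.
[cite: Rogawski1990, §3.5 Prop. 3.5.2 (c) p. 29; §4.9 Prop. 4.9.1 p. 55] [cite: Jacobowitz1962, §4] [cite: LabesseLanglands1979, §2 pp. 8–10] -/
theorem exists_partnerPlane (σ : E →+* E) (H₂ : Matrix (Fin 2) (Fin 2) E) (jE : E →+* M) (ρ Θ : M →+* M)
    (hρj : ∀ c, ρ (jE c) = jE c) (hΘj : ∀ c, Θ (jE c) = jE (σ c)) (hρρ : ∀ z, ρ (ρ z) = z) (hΘΘ : ∀ z, Θ (Θ z) = z) (hΘρ : ∀ z, Θ (ρ z) = ρ (Θ z))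
    (hjfix : ∀ z, ρ z = z ↔ ∃ c, jE c = z)
    (φ : (Fin 2 → E) →+ M) (hφs : ∀ (c : E) (x : Fin 2 → E), φ (c • x) = jE c * φ x)
    {g : Matrix (Fin 2) (Fin 2) E} {lam : M} (hφγ : ∀ x, φ (g.mulVec x) = lam * φ x) (hΘlam : Θ lam * lam = 1)
    {h : M} (hΘh : Θ h = h) (hform : ∀ x y, jE (pairing σ H₂ x y) = h * Θ (φ x) * φ y + ρ (h * Θ (φ x) * φ y))
    {n₀ : M} (hΘn : Θ n₀ = n₀) :
    ∃ Ψ : Matrix (Fin 2) (Fin 2) E,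
      (Ψ.map σ)ᵀ = Ψ ∧
      (∀ x y, pairing σ Ψ (g.mulVec x) (g.mulVec y) = pairing σ Ψ x y) ∧
      (∀ x y, jE (pairing σ Ψ x y) = (h * n₀) * Θ (φ x) * φ y + ρ ((h * n₀) * Θ (φ x) * φ y)) ∧
      jE Ψ.det = n₀ * ρ n₀ * jE H₂.det := by
  classical
  -- the twisted trace form on basis vectors is `ρ`-fixed, hence lies in `jE(E)`
  set c' : M := h * n₀ with hc'
  set e : Fin 2 → (Fin 2 → E) := fun i => Pi.single i 1 with he
  set T : Fin 2 → Fin 2 → M := fun i j => c' * Θ (φ (e i)) * φ (e j) + ρ (c' * Θ (φ (e i)) * φ (e j)) with hT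
  have hTfix : ∀ i j, ∃ c, jE c = T i j := fun i j => (hjfix _).1 (map_add_self_eq ρ hρρ _)
  choose ψ hψ using hTfix
  -- coordinates of `φ x` and the pairing of `Ψ := of ψ` in the model
  have hφx : ∀ x : Fin 2 → E, φ x = jE (x 0) * φ (e 0) + jE (x 1) * φ (e 1) := fun x => by
    conv_lhs => rw [eq_sum_single x]
    rw [map_add, hφs, hφs]
  have hformΨ : ∀ x y, jE (pairing σ (Matrix.of fun i j => ψ i j) x y) = c' * Θ (φ x) * φ y + ρ (c' * Θ (φ x) * φ y) := fun x y => by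
    rw [Literature.NumberTheory.Automorphic.UnitaryLatticeTree.pairing_apply, Fin.sum_univ_two, Fin.sum_univ_two, Fin.sum_univ_two]
    simp only [Matrix.of_apply, map_add, map_mul, hψ, hT, hφx x, hφx y, hΘj, hρj]
    ring
  -- the entries of `H₂` in the model
  have hH : ∀ i j, jE (H₂ i j) = h * Θ (φ (e i)) * φ (e j) + ρ (h * Θ (φ (e i)) * φ (e j)) := fun i j => by
    rw [← pairing_single_single σ H₂ i j]; exact hform _ _
  refine ⟨Matrix.of fun i j => ψ i j, ?_, ?_, hformΨ, ?_⟩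
  · -- hermitian: `σ (Ψ j i) = Ψ i j`, read through `jE` and `Θ`
    ext i j
    rw [Matrix.transpose_apply, Matrix.map_apply, Matrix.of_apply, Matrix.of_apply]
    apply jE.injective
    rw [← hΘj, hψ, hψ]
    simp only [hT, hc', map_add, map_mul, hΘΘ, hΘh, hΘn, hΘρ]
    ring
  · -- `g` is unitary for `Ψ`: `Θ(λ)·λ = 1`
    intro x y
    apply jE.injective
    rw [hformΨ, hformΨ, hφγ, hφγ, map_mul]
    have e1 : c' * (Θ lam * Θ (φ x)) * (lam * φ y) = c' * Θ (φ x) * φ y := by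
      linear_combination (c' * Θ (φ x) * φ y) * hΘlam
    rw [e1]
  · -- the determinant: `jE(det Ψ) = n₀ ρ(n₀) · jE(det H₂)`
    rw [Matrix.det_fin_two, Matrix.det_fin_two]
    simp only [Matrix.of_apply, map_sub, map_mul, hψ, hH, hT, hc']
    ring

end Summit.HodgeConjecture.HodgeConjecture.Cruxes.H413.F0P3cDyRamPartnerPlane

end
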